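import Mathlib.Combinatorics.SimpleGraph.Girth
import Mathlib.Combinatorics.SimpleGraph.Walk.Counting
import Mathlib.Combinatorics.SimpleGraph.Finite
import Mathlib.Algebra.BigOperators.Group.Finset.Sigma
import HarnessLib

/-!
# Short paths in graphs of large girth (combinatorial half of the Alon–Hoory–Linial Moore bound)

Support file for the proof of `Literature.Combinatorics.SimpleGraph.alonHooryLinial_mooreBound`
(Alon–Hoory–Linial 2002, Theorem 1).  Everything is fully proved; declarations live in the
sub-namespace `IrregularMoore` (the irregular Moore bound).

For a finite simple graph `H` we count PATHS (Mathlib `SimpleGraph.Walk.IsPath`) instead of the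
non-backtracking walks of [AlonHooryLinial2002]: below the girth the two notions coincide, and
Mathlib already knows that two distinct paths with the same endpoints span a cycle of length at
most the sum of their lengths (`SimpleGraph.Walk.IsPath.exists_isCycle_length_le_add_of_ne`).

* `avoidingPaths H A L x z` — the paths `x ⇝ z` of length `L` avoiding the vertex set `A`;
  `pathCount H j u v = ∑_z #avoidingPaths H {u} j v z` is the number of non-backtracking
  continuations of length `j` of the dart `u → v`.
* `card_avoidingPaths_succ` — first-step decomposition (a `cons` bijection).
* `pathCount_succ` — the non-backtracking recurrence
  `pathCount (j+1) u v = ∑_{w ∼ v, w ≠ u} pathCount j v w`, valid while `j + 3 ≤ girth`.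
* `pathFamily`, `card_pathFamily_le` and friends — the endpoints of the short paths issued from a
  vertex (odd girth) or from the two ends of an edge (even girth) are pairwise distinct
  ([AlonHooryLinial2002, p. 56], the "tree-like ball" argument), whence the counting inequalities
  `odd_count` and `even_count` used in `MooreBoundIrregular.lean`.

## References

* N. Alon, S. Hoory, N. Linial, The Moore bound for irregular graphs, *Graphs Combin.* 18
  (2002) 53–57 [AlonHooryLinial2002].
-/

namespace Literature.Combinatorics.SimpleGraph

namespace IrregularMoore

open Finset _root_.SimpleGraph _root_.SimpleGraph.Walk

variable {V : Type*} [Fintype V] [DecidableEq V] (H : _root_.SimpleGraph V) [DecidableRel H.Adj]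

omit [Fintype V] [DecidableRel H.Adj] in
/-- Two paths with the same endpoints and total length below the girth coincide
(from Mathlib's `IsPath.exists_isCycle_length_le_add_of_ne`). [folklore] -/
theorem path_unique_of_lt_girth {g : ℕ} (hg : (g : ℕ∞) ≤ H.egirth) {x z : V}
    {p q : H.Walk x z} (hp : p.IsPath) (hq : q.IsPath) (h : p.length + q.length < g) :
    p = q := by
  by_contra hne
  obtain ⟨w, -, -, c, hc, hcl⟩ := hp.exists_isCycle_length_le_add_of_ne hq hne
  have h1 : (g : ℕ∞) ≤ c.length := (le_egirth.mp hg) w c hc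
  have h2 : g ≤ c.length := by exact_mod_cast h1
  omega

/-- The paths `x ⇝ z` of length `L` in `H` avoiding every vertex of `A`. [folklore] -/
def avoidingPaths (A : Finset V) (L : ℕ) (x z : V) : Finset (H.Walk x z) :=
  {q ∈ H.finsetWalkLength L x z | q.IsPath ∧ ∀ a ∈ A, a ∉ q.support}

variable {H} in
/-- Membership in `avoidingPaths`. [folklore] -/
theorem mem_avoidingPaths {A : Finset V} {L : ℕ} {x z : V} {q : H.Walk x z} :
    q ∈ avoidingPaths H A L x z ↔ q.length = L ∧ q.IsPath ∧ ∀ a ∈ A, a ∉ q.support := by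
  simp [avoidingPaths, mem_finsetWalkLength_iff]

/-- Level `0`: the only path of length `0` from `x` is the trivial one. [folklore] -/
theorem sum_card_avoidingPaths_zero (A : Finset V) (x : V) (hx : x ∉ A) :
    ∑ z, #(avoidingPaths H A 0 x z) = 1 := by
  rw [Finset.sum_eq_single x]
  · rw [Finset.card_eq_one]
    refine ⟨Walk.nil, ?_⟩
    ext q
    rw [mem_avoidingPaths, Finset.mem_singleton]
    constructor
    · rintro ⟨hl, -, -⟩
      exact eq_nil_iff_nil.mpr (length_eq_zero_iff.mp hl)
    · rintro rfl
      refine ⟨rfl, IsPath.nil, fun a ha => ?_⟩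
      simp only [support_nil, List.mem_singleton]
      rintro rfl
      exact hx ha
  · intro z _ hzx
    rw [Finset.card_eq_zero, Finset.eq_empty_iff_forall_notMem]
    intro q hq
    rw [mem_avoidingPaths] at hq
    exact hzx (q.eq_of_length_eq_zero hq.1).symm
  · simp

/-- Membership in the sigma finset used in the first-step decomposition gives the first edge.
[folklore] -/
theorem adj_of_mem_sigma {A : Finset V} {L : ℕ} {x z : V} {s : Σ w, H.Walk w z}
    (hs : s ∈ ({w ∈ H.neighborFinset x | w ∉ A}).sigma
      (fun w => avoidingPaths H (insert x A) L w z)) : H.Adj x s.1 := by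
  rw [Finset.mem_sigma, Finset.mem_filter, mem_neighborFinset] at hs
  exact hs.1.1

/-- First-step decomposition (`cons` bijection): a path of length `L+1` from `x ∉ A` avoiding `A`
is an edge `x → w` (`w ∉ A`) followed by a path of length `L` from `w` avoiding `A ∪ {x}`.
[folklore] -/
theorem card_avoidingPaths_succ (A : Finset V) (L : ℕ) (x z : V) (hx : x ∉ A) :
    #(avoidingPaths H A (L + 1) x z)
      = ∑ w ∈ H.neighborFinset x with w ∉ A, #(avoidingPaths H (insert x A) L w z) := by
  rw [← Finset.card_sigma]
  symm
  refine Finset.card_bij (fun s hs => Walk.cons (adj_of_mem_sigma H hs) s.2) ?_ ?_ ?_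
  · rintro ⟨w, q⟩ hs
    have hadj := adj_of_mem_sigma H hs
    rw [Finset.mem_sigma, Finset.mem_filter, mem_avoidingPaths] at hs
    obtain ⟨⟨-, hwA⟩, hl, hq, hqA⟩ := hs
    rw [mem_avoidingPaths]
    refine ⟨by simp [hl], ?_, ?_⟩
    · rw [cons_isPath_iff]
      exact ⟨hq, hqA x (Finset.mem_insert_self x A)⟩
    · intro a ha
      rw [support_cons, List.mem_cons]
      rintro (rfl | h)
      · exact hx ha
      · exact hqA a (Finset.mem_insert_of_mem ha) h
  · rintro ⟨w₁, q₁⟩ h₁ ⟨w₂, q₂⟩ h₂ heq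
    simp only [Walk.cons.injEq] at heq
    obtain ⟨rfl, h⟩ := heq
    simp [eq_of_heq h]
  · intro p hp
    rw [mem_avoidingPaths] at hp
    obtain ⟨hl, hpath, hpA⟩ := hp
    cases p with
    | nil => simp at hl
    | @cons _ w _ hadj q =>
      rw [cons_isPath_iff] at hpath
      refine ⟨⟨w, q⟩, ?_, rfl⟩
      rw [Finset.mem_sigma, Finset.mem_filter, mem_neighborFinset, mem_avoidingPaths]
      refine ⟨⟨hadj, fun hw => hpA w hw (by simp)⟩, by simpa using hl, hpath.1, ?_⟩
      intro a ha
      rw [Finset.mem_insert] at ha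
      rcases ha with rfl | ha
      · exact hpath.2
      · exact fun h => hpA a ha (by simp [h])

/-- Below the girth, a path from a neighbour `w ≠ u` of `v` that avoids `v` also avoids `u`
(otherwise `u v w ⇝ u` closes a cycle of length `≤ L + 2 < g`).
[cite: AlonHooryLinial2002, p. 55] -/
theorem avoidingPaths_pair_eq {g : ℕ} (hg : (g : ℕ∞) ≤ H.egirth) {u v w : V} (huv : H.Adj u v)
    (hvw : H.Adj v w) (hwu : w ≠ u) (L : ℕ) (hL : L + 3 ≤ g) (z : V) :
    avoidingPaths H (insert v {u}) L w z = avoidingPaths H {v} L w z := by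
  ext q
  rw [mem_avoidingPaths, mem_avoidingPaths]
  simp only [Finset.mem_insert, Finset.mem_singleton, forall_eq_or_imp, forall_eq]
  constructor
  · rintro ⟨hl, hq, hv, -⟩
    exact ⟨hl, hq, hv⟩
  · rintro ⟨hl, hq, hv⟩
    refine ⟨hl, hq, hv, fun hu => ?_⟩
    -- the prefix `w ⇝ u` of `q` and the path `w → v → u` are two short paths `w ⇝ u`
    have hp1 : (q.takeUntil u hu).IsPath := hq.takeUntil hu
    have hv1 : v ∉ (q.takeUntil u hu).support :=
      fun h => hv (support_takeUntil_subset_support q hu h)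
    let q₂ : H.Walk w u := Walk.cons hvw.symm (Walk.cons huv.symm Walk.nil)
    have hp2 : q₂.IsPath := by
      simp only [q₂, cons_isPath_iff, support_cons, support_nil, List.mem_cons,
        List.not_mem_nil, or_false]
      exact ⟨⟨IsPath.nil, fun h => huv.ne h.symm⟩, fun h => h.elim hvw.ne' hwu⟩
    have hne : q.takeUntil u hu ≠ q₂ := by
      intro h
      apply hv1
      rw [h]
      simp [q₂]
    have hlen : (q.takeUntil u hu).length + q₂.length < g := by
      have := q.length_takeUntil_le_length hu
      simp only [q₂, length_cons, length_nil]
      omega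
    exact hne (path_unique_of_lt_girth H hg hp1 hp2 hlen)

/-- `pathCount H j u v`: the number of paths of length `j` starting at `v` and avoiding `u`.  For a
dart `u → v` these are its non-backtracking continuations of length `j` (below the girth), the
quantity `N_{uv,j}` of [cite: AlonHooryLinial2002, p. 55]. -/
def pathCount (j : ℕ) (u v : V) : ℕ := ∑ z, #(avoidingPaths H {u} j v z)

/-- A dart has exactly one continuation of length `0`. [cite: AlonHooryLinial2002, p. 55] -/
theorem pathCount_zero {u v : V} (huv : u ≠ v) : pathCount H 0 u v = 1 :=
  sum_card_avoidingPaths_zero H {u} v (by simpa using fun h => huv h.symm)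

/-- The non-backtracking recurrence for path counts, valid while `j + 3 ≤ girth`.
[cite: AlonHooryLinial2002, p. 55] -/
theorem pathCount_succ {g : ℕ} (hg : (g : ℕ∞) ≤ H.egirth) {u v : V} (huv : H.Adj u v) (j : ℕ)
    (hj : j + 3 ≤ g) :
    pathCount H (j + 1) u v = ∑ w ∈ (H.neighborFinset v).erase u, pathCount H j v w := by
  unfold pathCount
  have h1 : ∀ z, #(avoidingPaths H {u} (j + 1) v z)
      = ∑ w ∈ (H.neighborFinset v).erase u, #(avoidingPaths H {v} j w z) := by
    intro z
    rw [card_avoidingPaths_succ H {u} j v z (by simpa using huv.ne'), ← Finset.filter_ne']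
    refine Finset.sum_congr (by ext w; simp) fun w hw => ?_
    rw [Finset.mem_filter, mem_neighborFinset] at hw
    exact congrArg Finset.card (avoidingPaths_pair_eq H hg huv hw.1 hw.2 j hj z)
  simp_rw [h1]
  exact Finset.sum_comm

/-- All paths of length `< R` from `x` avoiding `A`, tagged with their endpoint (the ball of
radius `R - 1` around `x`, resp. around an edge, of [cite: AlonHooryLinial2002, p. 56]). -/
def pathFamily (A : Finset V) (R : ℕ) (x : V) : Finset (Σ z, H.Walk x z) :=
  Finset.univ.sigma fun z => (Finset.range R).biUnion fun L => avoidingPaths H A L x z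

variable {H} in
/-- Membership in `pathFamily`. [folklore] -/
theorem mem_pathFamily {A : Finset V} {R : ℕ} {x : V} {s : Σ z, H.Walk x z} :
    s ∈ pathFamily H A R x ↔ s.2.length < R ∧ s.2.IsPath ∧ ∀ a ∈ A, a ∉ s.2.support := by
  simp only [pathFamily, Finset.mem_sigma, Finset.mem_univ, true_and, Finset.mem_biUnion,
    Finset.mem_range, mem_avoidingPaths]
  constructor
  · rintro ⟨L, hL, hl, hp, hA⟩
    exact ⟨hl ▸ hL, hp, hA⟩
  · rintro ⟨hl, hp, hA⟩
    exact ⟨_, hl, rfl, hp, hA⟩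

/-- The size of a path family, level by level. [folklore] -/
theorem card_pathFamily (A : Finset V) (R : ℕ) (x : V) :
    #(pathFamily H A R x) = ∑ L ∈ Finset.range R, ∑ z, #(avoidingPaths H A L x z) := by
  rw [pathFamily, Finset.card_sigma, Finset.sum_comm]
  refine Finset.sum_congr rfl fun z _ => ?_
  rw [Finset.card_biUnion]
  intro L₁ _ L₂ _ hne
  rw [Function.onFun, Finset.disjoint_left]
  intro q h₁ h₂
  rw [mem_avoidingPaths] at h₁ h₂
  exact hne (h₁.1.symm.trans h₂.1)

/-- Endpoints of the members of a path family are pairwise distinct as soon as `2R ≤ g + 1`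
(two members with a common endpoint would span a cycle of length `≤ 2R - 2 < g`).
[cite: AlonHooryLinial2002, p. 56] -/
theorem pathFamily_injOn {g : ℕ} (hg : (g : ℕ∞) ≤ H.egirth) (A : Finset V) (R : ℕ) (x : V)
    (hR : 2 * R ≤ g + 1) :
    Set.InjOn (fun s : Σ z, H.Walk x z => s.1) (pathFamily H A R x) := by
  rintro ⟨z₁, p₁⟩ h₁ ⟨z₂, p₂⟩ h₂ hz
  simp only at hz
  subst hz
  simp only [Finset.mem_coe, mem_pathFamily] at h₁ h₂
  have := path_unique_of_lt_girth H hg h₁.2.1 h₂.2.1 (by omega)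
  subst this
  rfl

omit [Fintype V] [DecidableEq V] [DecidableRel H.Adj] in
/-- The endpoint of a walk starting in a set `S` that contains every vertex with a neighbour lies
in `S`. [folklore] -/
theorem end_mem_of_start_mem (S : Finset V) (hS : ∀ ⦃a b⦄, H.Adj a b → b ∈ S) {x z : V}
    (p : H.Walk x z) (hx : x ∈ S) : z ∈ S := by
  induction p with
  | nil => exact hx
  | cons h _ ih => exact ih (hS h)

/-- A path family issued from a live vertex has at most `#S` members when `2R ≤ g + 1`.
[cite: AlonHooryLinial2002, p. 56] -/
theorem card_pathFamily_le (S : Finset V) (hS : ∀ ⦃a b⦄, H.Adj a b → b ∈ S) {g : ℕ}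
    (hg : (g : ℕ∞) ≤ H.egirth) (A : Finset V) (R : ℕ) {x : V} (hx : x ∈ S)
    (hR : 2 * R ≤ g + 1) : #(pathFamily H A R x) ≤ #S :=
  Finset.card_le_card_of_injOn (fun s => s.1)
    (fun s _ => by simpa using end_mem_of_start_mem H S hS s.2 hx)
    (pathFamily_injOn H hg A R x hR)

/-- Odd girth `g ≥ 2r+1`: the `1 + ∑_{i<r} ∑_{w ∼ v} pathCount i v w` paths of length `≤ r`
issued from `v` have distinct endpoints. [cite: AlonHooryLinial2002, p. 56, odd case] -/
theorem odd_count (S : Finset V) (hS : ∀ ⦃a b⦄, H.Adj a b → b ∈ S) {g : ℕ}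
    (hg : (g : ℕ∞) ≤ H.egirth) (r : ℕ) (hr : 2 * r + 1 ≤ g) {v : V} (hv : v ∈ S) :
    1 + ∑ i ∈ Finset.range r, ∑ w ∈ H.neighborFinset v, pathCount H i v w ≤ #S := by
  have hcard := card_pathFamily_le H S hS hg ∅ (r + 1) hv (by omega)
  rw [card_pathFamily, Finset.sum_range_succ', sum_card_avoidingPaths_zero H ∅ v (by simp),
    add_comm] at hcard
  refine le_trans (le_of_eq ?_) hcard
  congr 1
  refine Finset.sum_congr rfl fun i _ => ?_
  unfold pathCount
  rw [Finset.sum_comm]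
  refine Finset.sum_congr rfl fun z _ => ?_
  rw [card_avoidingPaths_succ H ∅ i v z (by simp)]
  refine Finset.sum_congr (by ext w; simp) fun w _ => ?_
  rfl

/-- Even girth `g ≥ 2r`: the short paths issued from the two ends of an edge `u v` (length `< r`,
leaving the edge) have pairwise distinct endpoints. [cite: AlonHooryLinial2002, p. 56, even case] -/
theorem even_count (S : Finset V) (hS : ∀ ⦃a b⦄, H.Adj a b → b ∈ S) {g : ℕ}
    (hg : (g : ℕ∞) ≤ H.egirth) (r : ℕ) (hr : 2 * r ≤ g) {u v : V} (huv : H.Adj u v)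
    (hu : u ∈ S) (hv : v ∈ S) :
    ∑ i ∈ Finset.range r, pathCount H i u v + ∑ i ∈ Finset.range r, pathCount H i v u ≤ #S := by
  have hA : #(pathFamily H {u} r v) = ∑ i ∈ Finset.range r, pathCount H i u v :=
    card_pathFamily H {u} r v
  have hB : #(pathFamily H {v} r u) = ∑ i ∈ Finset.range r, pathCount H i v u :=
    card_pathFamily H {v} r u
  have hinjA := pathFamily_injOn H hg {u} r v (by omega)
  have hinjB := pathFamily_injOn H hg {v} r u (by omega)
  rw [← hA, ← hB, ← Finset.card_image_of_injOn hinjA, ← Finset.card_image_of_injOn hinjB,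
    ← Finset.card_union_of_disjoint]
  · apply Finset.card_le_card
    intro z hz
    rw [Finset.mem_union, Finset.mem_image, Finset.mem_image] at hz
    rcases hz with ⟨s, _, rfl⟩ | ⟨s, _, rfl⟩
    · exact end_mem_of_start_mem H S hS s.2 hv
    · exact end_mem_of_start_mem H S hS s.2 hu
  · rw [Finset.disjoint_left]
    rintro z hzA hzB
    rw [Finset.mem_image] at hzA hzB
    obtain ⟨⟨z₁, p⟩, hp, rfl⟩ := hzA
    obtain ⟨⟨z₂, q⟩, hq, hz⟩ := hzB
    simp only at hz
    subst hz
    rw [mem_pathFamily] at hp hq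
    simp only [Finset.mem_singleton, forall_eq] at hp hq
    obtain ⟨hpl, hpp, hpu⟩ := hp
    obtain ⟨hql, hqp, hqv⟩ := hq
    -- `u → v ⇝ z₂` (via `p`) and `q : u ⇝ z₂` are distinct short paths
    have hP : (Walk.cons huv p).IsPath := (cons_isPath_iff huv p).mpr ⟨hpp, hpu⟩
    have hne : Walk.cons huv p ≠ q := by
      intro h
      apply hqv
      rw [← h, support_cons]
      exact List.mem_cons_of_mem u p.start_mem_support
    exact hne (path_unique_of_lt_girth H hg hP hqp (by simp only [length_cons]; omega))

end IrregularMoore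

end Literature.Combinatorics.SimpleGraph
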